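import Summits.HodgeConjecture.HodgeConjecture.Theorems.HeckePrymWeilWeilVariationalHodgeReductions
import Summits.HodgeConjecture.HodgeConjecture.Theorems.HeckePrymWeilWeilVariationalHodgeLowRungs
import Summits.HodgeConjecture.HodgeConjecture.Theorems.HeckePrymWeilWeilVariationalHodgeSectionedCurveReduction
import Summits.HodgeConjecture.HodgeConjecture.Theorems.HeckePrymWeilWeilVariationalHodgeCurveDichotomy
import Literature.AlgebraicGeometry.Motives.AbelianSchemeProjective

/-!
# Route HeckePrymWeil — `WeilVariationalHodge` (stmt-HodgeConjecture-14497): the crux is its core over sectioned curves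

Certificate of skeleton v5 of line `Sketch` (lead c3). Write CORE(p, M) for the statement of the one remaining
substantive stub `stub_anchorSpreadsUncountably`:

> along a smooth projective family `f : 𝒳 ⟶ C` of relative dimension `2M`, `M ≥ 2`, carrying a SECTION
> `e : C ⟶ 𝒳`, with quasi-projective total space, over a smooth irreducible affine CURVE `C`, all of whose complex
> fibres are abelian `2M`-folds with `φ' ≫ φ' = -p`, and for a global class `W ∈ H^{2M}(𝒳(ℂ); ℂ)` fibrewise
> rational of type `(M,M)`: if `W|_{𝒳_{s₀}}` is algebraic for ONE `s₀ ∈ C(ℂ)`, then the set of `t ∈ C(ℂ)` with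
> `W|_{𝒳_t}` algebraic is NOT COUNTABLE.

This file proves, sorry-free:

* `anchorSpreadsUncountably_of_weilVariationalHodge` — **crux ⇒ CORE** for all `p`, `M ≥ 2`, unconditionally
  (the crux makes every fibre algebraic, and a smooth curve has uncountably many complex points:
  `not_countable_of_forall_mem_algebraicClasses_curve`);
* `weilVariationalHodge_of_raynaud_of_anchorSpreadsUncountably` — **CORE (all `p`, `M ≥ 2`) ⇒ crux**, granted the
  vendored classical fact `Motives.raynaud1970_abelianScheme_section_projective` (p143462: a sectioned smooth
  proper family with abelian complex fibres over a smooth affine base is H-projective — Laurent–Schröer 2023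
  Prop. 4.3 / GIT Thm. 6.14, Raynaud 1970 XI 1.4 = Görtz–Wedhorn II Thm. 27.291): the composition of skeleton v5
  — rung `M = 1` by Lefschetz `(1,1)` (`weilVariationalHodge_iff_two_le`, p140813), reduction to affine bases
  (`stub_affineReduction`, p138186), to SECTIONED families over smooth affine CURVES
  (`stub_sectionedCurveReduction`, p142539), quasi-projectivity of the total space from the fact
  (`isQuasiProjectiveOver_of_isClosedImmersion_of_isAffine`), and the all-or-countable dichotomy for the
  algebraicity locus over a curve (`stub_curveDichotomy` / `mem_algebraicClasses_of_not_countable_curve`, p141888,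
  from the tree's theorem `charlesSchnell_algebraicityLocus_iUnion_closed_holds`);
* `weilVariationalHodge_iff_anchorSpreadsUncountably_of_raynaud` — **granted the fact, crux ⟺ CORE.**

Reading: modulo one classical theorem of scheme theory, stmt-HodgeConjecture-14497 IS the statement that along
√-p abelian pencils over curves one algebraic fibre produces a continuum of algebraic fibres. Countable supplies
of algebraic fibres (isogeny / Hecke orbits of the anchor, CM fibres) are thereby certified insufficient; any
engine must deform a cycle over an uncountable (equivalently, by `map_fiberι_mem_algebraicClasses_of_isOpen` and
`variationalHodge_curve_dominance`, a Euclidean-open or Zariski-open) set of the curve.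
-/

noncomputable section

-- every declaration of this problem lives in `Summit.HodgeConjecture.HodgeConjecture.…` (summit = sub-problem)
set_option linter.dupNamespace false

open CategoryTheory AlgebraicGeometry TopologicalSpace MonoidalCategory
open Literature.AlgebraicGeometry.Motives Literature.AlgebraicGeometry.HodgeTheory
open Summit.HodgeConjecture.HodgeConjecture.Theses

namespace Summit.HodgeConjecture.HodgeConjecture.Theorems

/-- **Crux ⇒ CORE, unconditionally.** If the crux holds, then along any family as in CORE every fibre
restriction of `W` is algebraic, so the algebraicity locus is all of `C(ℂ)`, which is uncountable
(`not_countable_of_forall_mem_algebraicClasses_curve`; `C(ℂ) ≠ ∅` because of the anchor). The section, the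
quasi-projectivity, affineness, `dim C = 1` and `M ≥ 2` are idle in this direction. [folklore] -/
theorem anchorSpreadsUncountably_of_weilVariationalHodge (hV : HeckePrymWeil.WeilVariationalHodge)
    (p M : ℕ) (hp : p.Prime) (hp4 : p % 4 = 3) (hp7 : 7 ≤ p) (hM : 2 ≤ M) :
    ∀ ⦃𝒳 C : SchemeOver ℂ⦄ (f : 𝒳 ⟶ C) (e : C ⟶ 𝒳), e ≫ f = 𝟙 C → IsSmoothProjectiveFamily f (2 * M) →
      IsQuasiProjectiveOver 𝒳 → IrreducibleSpace C.left → IsAffine C.left → AlgebraicGeometry.Smooth C.hom →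
      topologicalKrullDim C.left = 1 → ∀ (W : complexBetti 𝒳 (2 * M)),
      (∀ s : ComplexPoints C, IsRationalClass (complexBetti.map (fiberι f s) (2 * M) W) ∧
        IsOfHodgeType (2 * M) (fiberOver f s) (2 * M) M M (complexBetti.map (fiberι f s) (2 * M) W)) →
      (∀ s : ComplexPoints C, ∃ (A' : AbelianVariety ℂ) (φ' : A' ⟶ A'), A'.dim = (2 * M) ∧
        φ' ≫ φ' = -((p : ℤ) • 𝟙 A') ∧ Nonempty (A'.X ≅ fiberOver f s)) →
      (∃ s₀ : ComplexPoints C, complexBetti.map (fiberι f s₀) (2 * M) W ∈ algebraicClasses (fiberOver f s₀) M) →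
      ¬ Set.Countable {t : ComplexPoints C |
          complexBetti.map (fiberι f t) (2 * M) W ∈ algebraicClasses (fiberOver f t) M} := by
  intro 𝒳 C f _ _ hf _ hirr haff hsm hdim W hW hA hanch
  haveI := hirr
  haveI := haff
  haveI := hsm
  obtain ⟨s₀, _⟩ := id hanch
  haveI : Nonempty (ComplexPoints C) := ⟨s₀⟩
  exact not_countable_of_forall_mem_algebraicClasses_curve f hdim W
    (hV p hp hp4 hp7 M (by omega) f hf hirr hsm W hW hA hanch)

/-- **CORE (all `p`, `M ≥ 2`) ⇒ crux, granted `raynaud1970_abelianScheme_section_projective`** — the composition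
of skeleton v5 with its two stubs as hypotheses: rung `M = 1` by Lefschetz `(1,1)`
(`weilVariationalHodge_iff_two_le`); affine bases (`stub_affineReduction`); sectioned curve bases
(`stub_sectionedCurveReduction`); over a sectioned curve the fact makes the total space quasi-projective
(`isQuasiProjectiveOver_of_isClosedImmersion_of_isAffine`), the algebraicity locus is everything or countable
(`mem_algebraicClasses_of_not_countable_curve`), and CORE excludes countable. CONDITIONAL on the named fact.
[cite: GortzWedhorn2023, §(27.53) Thm. 27.291] [cite: LaurentSchroer2023, §4 Prop. 4.3]
[cite: CharlesSchnell2014Notes, Prop. 11.3.11 (proof)] [cite: MumfordAV1970, §6, Lemma] -/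
theorem weilVariationalHodge_of_raynaud_of_anchorSpreadsUncountably
    (hR : raynaud1970_abelianScheme_section_projective)
    (hU : ∀ p : ℕ, p.Prime → p % 4 = 3 → 7 ≤ p → ∀ M : ℕ, 2 ≤ M →
      ∀ ⦃𝒳 C : SchemeOver ℂ⦄ (f : 𝒳 ⟶ C) (e : C ⟶ 𝒳), e ≫ f = 𝟙 C → IsSmoothProjectiveFamily f (2 * M) →
      IsQuasiProjectiveOver 𝒳 → IrreducibleSpace C.left → IsAffine C.left → AlgebraicGeometry.Smooth C.hom →
      topologicalKrullDim C.left = 1 → ∀ (W : complexBetti 𝒳 (2 * M)),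
      (∀ s : ComplexPoints C, IsRationalClass (complexBetti.map (fiberι f s) (2 * M) W) ∧
        IsOfHodgeType (2 * M) (fiberOver f s) (2 * M) M M (complexBetti.map (fiberι f s) (2 * M) W)) →
      (∀ s : ComplexPoints C, ∃ (A' : AbelianVariety ℂ) (φ' : A' ⟶ A'), A'.dim = (2 * M) ∧
        φ' ≫ φ' = -((p : ℤ) • 𝟙 A') ∧ Nonempty (A'.X ≅ fiberOver f s)) →
      (∃ s₀ : ComplexPoints C, complexBetti.map (fiberι f s₀) (2 * M) W ∈ algebraicClasses (fiberOver f s₀) M) →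
      ¬ Set.Countable {t : ComplexPoints C |
          complexBetti.map (fiberι f t) (2 * M) W ∈ algebraicClasses (fiberOver f t) M}) :
    HeckePrymWeil.WeilVariationalHodge := by
  refine weilVariationalHodge_iff_two_le.2 fun p hp hp4 hp7 M hM => ?_
  refine stub_affineReduction p M (stub_sectionedCurveReduction p M ?_)
  intro 𝒳 C f e he hf hirr haff hsm hdim W hW hA hanch s
  haveI := haff
  haveI := hsm
  have hqp : IsQuasiProjectiveOver 𝒳 :=
    isQuasiProjectiveOver_of_isClosedImmersion_of_isAffine
      (hR f e he hf.smooth hf.isProper haff hsm fun t => by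
        obtain ⟨A', -, -, -, h⟩ := hA t
        exact ⟨A', h⟩)
  exact mem_algebraicClasses_of_not_countable_curve f hf hqp hdim W
    (hU p hp hp4 hp7 M hM f e he hf hqp hirr haff hsm hdim W hW hA hanch) s

/-- **Granted `raynaud1970_abelianScheme_section_projective`, the crux is EQUIVALENT to its core over sectioned
curves**: stmt-HodgeConjecture-14497 (Grothendieck's variational Hodge statement along smooth proper √-p abelian
families over arbitrary smooth irreducible bases, all `M ≥ 1`) holds iff, along sectioned H-projective √-p
abelian families over smooth irreducible affine curves with `M ≥ 2`, one algebraic fibre of a fibrewise-rational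
`(M,M)` global class forces uncountably many (`anchorSpreadsUncountably_of_weilVariationalHodge`,
`weilVariationalHodge_of_raynaud_of_anchorSpreadsUncountably`). CONDITIONAL on the named fact (used in `←` only).
[cite: GortzWedhorn2023, §(27.53) Thm. 27.291] [cite: CharlesSchnell2014Notes, Prop. 11.3.11 (proof)] -/
theorem weilVariationalHodge_iff_anchorSpreadsUncountably_of_raynaud
    (hR : raynaud1970_abelianScheme_section_projective) :
    HeckePrymWeil.WeilVariationalHodge ↔
    ∀ p : ℕ, p.Prime → p % 4 = 3 → 7 ≤ p → ∀ M : ℕ, 2 ≤ M →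
      ∀ ⦃𝒳 C : SchemeOver ℂ⦄ (f : 𝒳 ⟶ C) (e : C ⟶ 𝒳), e ≫ f = 𝟙 C → IsSmoothProjectiveFamily f (2 * M) →
      IsQuasiProjectiveOver 𝒳 → IrreducibleSpace C.left → IsAffine C.left → AlgebraicGeometry.Smooth C.hom →
      topologicalKrullDim C.left = 1 → ∀ (W : complexBetti 𝒳 (2 * M)),
      (∀ s : ComplexPoints C, IsRationalClass (complexBetti.map (fiberι f s) (2 * M) W) ∧
        IsOfHodgeType (2 * M) (fiberOver f s) (2 * M) M M (complexBetti.map (fiberι f s) (2 * M) W)) →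
      (∀ s : ComplexPoints C, ∃ (A' : AbelianVariety ℂ) (φ' : A' ⟶ A'), A'.dim = (2 * M) ∧
        φ' ≫ φ' = -((p : ℤ) • 𝟙 A') ∧ Nonempty (A'.X ≅ fiberOver f s)) →
      (∃ s₀ : ComplexPoints C, complexBetti.map (fiberι f s₀) (2 * M) W ∈ algebraicClasses (fiberOver f s₀) M) →
      ¬ Set.Countable {t : ComplexPoints C |
          complexBetti.map (fiberι f t) (2 * M) W ∈ algebraicClasses (fiberOver f t) M} :=
  ⟨fun hV p hp hp4 hp7 M hM => anchorSpreadsUncountably_of_weilVariationalHodge hV p M hp hp4 hp7 hM,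
    weilVariationalHodge_of_raynaud_of_anchorSpreadsUncountably hR⟩

end Summit.HodgeConjecture.HodgeConjecture.Theorems

end
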